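import Mathlib

/-!
# SoloBlind kernel #214 — coercive solvability: the numerical-range resolvent bound

The ω-tail of the Plancherel functionals in LEMMA R (A8-CAP, §10 (I) item 4) uses
`‖(z - J)⁻¹‖ ≤ 1 / dist(z, W(J))`: if `|⟪x, T x⟫| ≥ δ ‖x‖²` for all `x` (e.g. `T = z - J` with `z` at
distance `δ` from the numerical range), then `‖T x‖ ≥ δ ‖x‖`, `T` is injective, hence (finite
dimension) surjective, and every `y` has a preimage of norm at most `‖y‖ / δ`.
-/

namespace Summit.AnomalousDissipation.AnomalousDissipation.Theorems

open scoped InnerProductSpace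

variable {E : Type*} [NormedAddCommGroup E] [InnerProductSpace ℂ E]

/-- Coercivity of the quadratic form gives a lower bound `δ ‖x‖ ≤ ‖T x‖`. -/
theorem coercive_lower_bound (T : E →ₗ[ℂ] E) (δ : ℝ)
    (hco : ∀ x : E, δ * ‖x‖ ^ 2 ≤ ‖⟪x, T x⟫_ℂ‖) (x : E) : δ * ‖x‖ ≤ ‖T x‖ := by
  by_cases hx : x = 0
  · simp [hx]
  · have hxpos : 0 < ‖x‖ := norm_pos_iff.mpr hx
    have h1 : δ * ‖x‖ ^ 2 ≤ ‖x‖ * ‖T x‖ := le_trans (hco x) (norm_inner_le_norm x (T x))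
    have h2 : δ * ‖x‖ * ‖x‖ ≤ ‖T x‖ * ‖x‖ := by nlinarith
    exact le_of_mul_le_mul_right h2 hxpos

/-- A coercive endomorphism is injective (for `δ > 0`). -/
theorem coercive_injective (T : E →ₗ[ℂ] E) (δ : ℝ) (hδ : 0 < δ)
    (hco : ∀ x : E, δ * ‖x‖ ^ 2 ≤ ‖⟪x, T x⟫_ℂ‖) : Function.Injective T := by
  rw [← LinearMap.ker_eq_bot, LinearMap.ker_eq_bot']
  intro x hx
  have h := coercive_lower_bound T δ hco x
  rw [hx, norm_zero] at h
  have : ‖x‖ ≤ 0 := by nlinarith [norm_nonneg x]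
  exact norm_le_zero_iff.mp this

/-- **Coercive solvability with the resolvent bound.** In finite dimension a coercive endomorphism is
onto, and the solution of `T x = y` obeys `δ ‖x‖ ≤ ‖y‖`. -/
theorem coercive_solve [FiniteDimensional ℂ E] (T : E →ₗ[ℂ] E) (δ : ℝ) (hδ : 0 < δ)
    (hco : ∀ x : E, δ * ‖x‖ ^ 2 ≤ ‖⟪x, T x⟫_ℂ‖) (y : E) :
    ∃ x : E, T x = y ∧ δ * ‖x‖ ≤ ‖y‖ := by
  have hinj := coercive_injective T δ hδ hco
  have hsurj : Function.Surjective T := LinearMap.surjective_of_injective hinj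
  obtain ⟨x, hx⟩ := hsurj y
  refine ⟨x, hx, ?_⟩
  have := coercive_lower_bound T δ hco x
  rwa [hx] at this

/-- The form in which it is used: a uniform bound on the real part of the numerical range of `T`
away from zero, `δ ‖x‖² ≤ Re ⟪x, T x⟫`, implies the coercivity hypothesis. -/
theorem coercive_of_re (T : E →ₗ[ℂ] E) (δ : ℝ)
    (hre : ∀ x : E, δ * ‖x‖ ^ 2 ≤ (⟪x, T x⟫_ℂ).re) (x : E) : δ * ‖x‖ ^ 2 ≤ ‖⟪x, T x⟫_ℂ‖ :=
  le_trans (hre x) (Complex.re_le_norm _)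

end Summit.AnomalousDissipation.AnomalousDissipation.Theorems
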